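import Summits.BirchSwinnertonDyer.BirchSwinnertonDyer.Theorems.KimAtThreeFineKatoValueEquivarianceStabAll
import HarnessLib

/-!
# `ZetaBody` (C3a)/(C3b) for the single-completion value datum, read DIRECTLY on the displayed cocycle-level
# clause (DEF₀) of `hKdef₀` / `hKatoV2₀` (crux `KatoKuriharaPortThreeShared`, stmt-BirchSwinnertonDyer-19560;
# cell `bsd-addord`, seat w2-acc5 gen 5; route W2 `KimAtThreeKolyvagin`; `--supports 19560`, helper)

HONEST FRAMING.  TOOL theorems only (no definition, no named fact, no `sorry`); every `p`, `k`, `r`;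
closes nothing; nothing is booked; BSD is not proved by any of this.

WHAT.  The packages `hKdef₀` (w2-acc5 p506982) and `hKatoV2₀` (kim3 p508902) display the definition of
the value datum ON COCYCLES: **(DEF₀)** «`[φ''] = conjMap (g w) y → (∀ τ, ψT τ = φ'' (t τ)) →
Ψ (Λ y)_w = S_w (φ₀ [ψT])`», `φ₀` the defined `exp*_{w₀}` on `H¹(Γ_{L_{w₀}}, T)` (tower action),
`S_w = galAdicCompletionMap (g̃_w)⁻¹`.  The (C3a)/(C3b) theorems of `KimAtThreeFineKatoValueEquivariance`
are stated on CLASSES with `F = φ₀ ∘ loc^{tower}_{w₀} ∘ H1toInt`.  THIS FILE bridges the two and composes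
with `KimAtThreeFineKatoValueEquivarianceStabAll`:

* `singleField_classDef_of_cocycleDef` — (DEF₀) on cocycles ⟹ the class-level definition
  `Ψ(Λ y)_w = S_w (φ₀ (loc^{tower}_{w₀} (H1toInt (g_w · y))))` (`exists_level_towerCocycle`,
  `locTower_H1toInt_oneCocycleClass`).
* `zetaBody_C3b_of_cocycleDef` — **(C3b) VERBATIM from (DEF₀) alone.**
* `zetaBody_C3a_of_cocycleDef_of_galDecomposition` — **(C3a) VERBATIM from (DEF₀) and the LOCAL
  equivariance (GAL_D)** «`φ₀ (loc (H1toInt (res δ̂ · Y))) = (res δ̂)~_* (φ₀ (loc (H1toInt Y)))` for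
  `δ̂ ∈ Γ_{ℚ_v}` whose image fixes `w₀`» — at EVERY level (the Stab-reduction of `…StabAll`).

So, for the Kato-v2 supplier of `hKatoV2₀`'s `ZetaBody` conjunct: (C3b) costs nothing beyond (DEF₀), and
(C3a) costs exactly (GAL_D) — `Gal(L_{w₀}/ℚ_p)`-semilinearity of the DEFINED `exp*_{w₀} ∘ loc_{w₀}`.

References: K. Kato, Astérisque 295 (2004) §9.4 [Kato2004Asterisque]; J. Neukirch, *Algebraic Number Theory*
(1999) Ch. I §9, Ch. II §9 (9.6) [NeukirchANT1999]; J.-P. Serre, *Galois Cohomology* (1997) I §2.4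
[SerreGaloisCohomology1997].
-/

noncomputable section

-- the cell's Theorems namespace `Summit.BirchSwinnertonDyer.BirchSwinnertonDyer.…` repeats the summit name by design (D-0017)
set_option linter.dupNamespace false

open scoped Classical NumberField ContRepresentation TensorProduct Pointwise
open Field NumberField IsDedekindDomain
open WeierstrassCurve Literature.NumberTheory.EllipticCurves Literature.NumberTheory.GaloisRepresentations
  Literature.NumberTheory.GaloisRepresentations.DiscreteGaloisModule
  Literature.NumberTheory.EllipticCurves.Kato2004.EulerSystemValues
open Literature.NumberTheory.AdelicBaseChange Literature.NumberTheory.Automorphic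
open Summit.BirchSwinnertonDyer.Rank1Residual.GaloisImage
open Summit.BirchSwinnertonDyer.BirchSwinnertonDyer.Theorems.KimAtThreeFineKatoLevelCompat
open Summit.BirchSwinnertonDyer.BirchSwinnertonDyer.Theorems.KimAtThreeFineKatoLevelCompatDef
open Summit.BirchSwinnertonDyer.BirchSwinnertonDyer.Theorems.KimAtThreeFineKatoValueEquivariance
open Summit.BirchSwinnertonDyer.BirchSwinnertonDyer.Theorems.KimAtThreeFineKatoValueEquivarianceStabAll

namespace Summit.BirchSwinnertonDyer.BirchSwinnertonDyer.Theorems.KimAtThreeFineKatoValueEquivarianceBridge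

variable (W : WeierstrassCurve ℚ) [W.IsElliptic] (p : ℕ) [hp : Fact p.Prime]
  [ContinuousSMul ℤ_[p] (W.tateModule p)] (k : ℕ) (r : Finset (HeightOneSpectrum (𝓞 ℚ)))
  (Λ : H1 (tateRep W p) (cycSubgroup p k r) →ₗ[ℤ_[p]] ℚ_[p] ⊗[ℚ] CyclotomicField (cycLevel p k r) ℚ)
  (Ψ : ℚ_[p] ⊗[ℚ] CyclotomicField (cycLevel p k r) ℚ ≃ₐ[ℚ]
    (Π w : ((Rat.HeightOneSpectrum.primesEquiv (R := 𝓞 ℚ)).symm ⟨p, Fact.out⟩).Extension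
      (𝓞 (CyclotomicField (cycLevel p k r) ℚ)), w.1.adicCompletion (CyclotomicField (cycLevel p k r) ℚ)))
  (w₀ : ((Rat.HeightOneSpectrum.primesEquiv (R := 𝓞 ℚ)).symm ⟨p, Fact.out⟩).Extension
    (𝓞 (CyclotomicField (cycLevel p k r) ℚ)))
  [Algebra (Place.Completion (Sum.inr ((Rat.HeightOneSpectrum.primesEquiv (R := 𝓞 ℚ)).symm ⟨p, Fact.out⟩)))
    (w₀.1.adicCompletion (CyclotomicField (cycLevel p k r) ℚ))]
  (hU : ∀ τ, absGaloisRestrictTower ℚ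
    (Place.Completion (Sum.inr ((Rat.HeightOneSpectrum.primesEquiv (R := 𝓞 ℚ)).symm ⟨p, Fact.out⟩)))
    (w₀.1.adicCompletion (CyclotomicField (cycLevel p k r) ℚ)) τ ∈ cycSubgroup p k r)
  {V : Type} [AddCommGroup V]
  (φ₀ : ((tateLocalRep W p (Sum.inr ((Rat.HeightOneSpectrum.primesEquiv (R := 𝓞 ℚ)).symm ⟨p, Fact.out⟩))).restrict
    (absGaloisRestrict (Place.Completion (Sum.inr ((Rat.HeightOneSpectrum.primesEquiv (R := 𝓞 ℚ)).symm ⟨p, Fact.out⟩)))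
      (w₀.1.adicCompletion (CyclotomicField (cycLevel p k r) ℚ)))).cohomology 1 →+ V)
  (S : ∀ w : ((Rat.HeightOneSpectrum.primesEquiv (R := 𝓞 ℚ)).symm ⟨p, Fact.out⟩).Extension
    (𝓞 (CyclotomicField (cycLevel p k r) ℚ)), V →+ w.1.adicCompletion (CyclotomicField (cycLevel p k r) ℚ))
  (g : ((Rat.HeightOneSpectrum.primesEquiv (R := 𝓞 ℚ)).symm ⟨p, Fact.out⟩).Extension
    (𝓞 (CyclotomicField (cycLevel p k r) ℚ)) → absoluteGaloisGroup ℚ)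

set_option backward.isDefEq.respectTransparency false in
/-- **(DEF₀) on cocycles ⟹ the class-level definition.**  If `Ψ(Λ y)_w = S_w (φ₀ [ψT])` for every cocycle
`φ''` representing `g_w · y` and its tower cocycle `ψT` (the displayed (DEF₀)), then
`Ψ(Λ y)_w = S_w (φ₀ (loc^{tower}_{w₀} (H1toInt (g_w · y))))` for every class `y`. [cite: SerreGaloisCohomology1997, I §2.4] -/
theorem singleField_classDef_of_cocycleDef
    (hdef : ∀ (w : ((Rat.HeightOneSpectrum.primesEquiv (R := 𝓞 ℚ)).symm ⟨p, Fact.out⟩).Extension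
        (𝓞 (CyclotomicField (cycLevel p k r) ℚ)))
      (y : H1 (tateRep W p) (cycSubgroup p k r))
      (φ'' : contOneCocycles (subgroupRep (tateRep W p).toTopRep (cycSubgroup p k r)))
      (ψT : contOneCocycles ((tateLocalRep W p (Sum.inr ((Rat.HeightOneSpectrum.primesEquiv (R := 𝓞 ℚ)).symm ⟨p, Fact.out⟩))).restrict
        (absGaloisRestrict (Place.Completion (Sum.inr ((Rat.HeightOneSpectrum.primesEquiv (R := 𝓞 ℚ)).symm ⟨p, Fact.out⟩)))
          (w₀.1.adicCompletion (CyclotomicField (cycLevel p k r) ℚ)))).toTopRep),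
      oneCocycleClass _ φ'' = conjMap (tateRep W p).toTopRep (cycSubgroup p k r) (g w) 1 y →
      (∀ σ, ψT.1 σ = φ''.1 ⟨absGaloisRestrictTower ℚ
        (Place.Completion (Sum.inr ((Rat.HeightOneSpectrum.primesEquiv (R := 𝓞 ℚ)).symm ⟨p, Fact.out⟩)))
        (w₀.1.adicCompletion (CyclotomicField (cycLevel p k r) ℚ)) σ, hU σ⟩) →
      Ψ (Λ y) w = S w (φ₀ (oneCocycleClass _ ψT)))
    (w : ((Rat.HeightOneSpectrum.primesEquiv (R := 𝓞 ℚ)).symm ⟨p, Fact.out⟩).Extension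
      (𝓞 (CyclotomicField (cycLevel p k r) ℚ)))
    (y : H1 (tateRep W p) (cycSubgroup p k r)) :
    Ψ (Λ y) w = S w (φ₀ (locTower ℚ
      (Place.Completion (Sum.inr ((Rat.HeightOneSpectrum.primesEquiv (R := 𝓞 ℚ)).symm ⟨p, Fact.out⟩)))
      (w₀.1.adicCompletion (CyclotomicField (cycLevel p k r) ℚ)) (tateRep W p).toIntRep.toTopRep
      (cycSubgroup p k r) hU 1
      (((tateRep W p).level (cycSubgroup p k r)).H1toInt
        (conjMap (tateRep W p).toTopRep (cycSubgroup p k r) (g w) 1 y)))) := by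
  obtain ⟨φ'', hφ''⟩ := oneCocycleClass_surjective (subgroupRep (tateRep W p).toTopRep (cycSubgroup p k r))
    (conjMap (tateRep W p).toTopRep (cycSubgroup p k r) (g w) 1 y)
  obtain ⟨ψT, hψT⟩ := exists_level_towerCocycle W p
    ((Rat.HeightOneSpectrum.primesEquiv (R := 𝓞 ℚ)).symm ⟨p, Fact.out⟩)
    (w₀.1.adicCompletion (CyclotomicField (cycLevel p k r) ℚ)) (cycSubgroup p k r) hU φ''
  rw [hdef w y φ'' ψT hφ'' hψT, ← hφ'',
    locTower_H1toInt_oneCocycleClass W p k r _ _ hU φ'' ψT hψT]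

set_option backward.isDefEq.respectTransparency false in
/-- **`ZetaBody` (C3b) VERBATIM from the displayed (DEF₀) alone** (every level): a class dying on every
`U ⊓ D_𝔓`, `𝔓 ∣ p`, has `Λ y = 0`. [cite: Kato2004Asterisque, §9.4 (p. 188)] -/
theorem zetaBody_C3b_of_cocycleDef
    (hdef : ∀ (w : ((Rat.HeightOneSpectrum.primesEquiv (R := 𝓞 ℚ)).symm ⟨p, Fact.out⟩).Extension
        (𝓞 (CyclotomicField (cycLevel p k r) ℚ)))
      (y : H1 (tateRep W p) (cycSubgroup p k r))
      (φ'' : contOneCocycles (subgroupRep (tateRep W p).toTopRep (cycSubgroup p k r)))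
      (ψT : contOneCocycles ((tateLocalRep W p (Sum.inr ((Rat.HeightOneSpectrum.primesEquiv (R := 𝓞 ℚ)).symm ⟨p, Fact.out⟩))).restrict
        (absGaloisRestrict (Place.Completion (Sum.inr ((Rat.HeightOneSpectrum.primesEquiv (R := 𝓞 ℚ)).symm ⟨p, Fact.out⟩)))
          (w₀.1.adicCompletion (CyclotomicField (cycLevel p k r) ℚ)))).toTopRep),
      oneCocycleClass _ φ'' = conjMap (tateRep W p).toTopRep (cycSubgroup p k r) (g w) 1 y →
      (∀ σ, ψT.1 σ = φ''.1 ⟨absGaloisRestrictTower ℚ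
        (Place.Completion (Sum.inr ((Rat.HeightOneSpectrum.primesEquiv (R := 𝓞 ℚ)).symm ⟨p, Fact.out⟩)))
        (w₀.1.adicCompletion (CyclotomicField (cycLevel p k r) ℚ)) σ, hU σ⟩) →
      Ψ (Λ y) w = S w (φ₀ (oneCocycleClass _ ψT)))
    (y : H1 (tateRep W p) (cycSubgroup p k r))
    (hy : ∀ v : HeightOneSpectrum (𝓞 ℚ), ((Rat.HeightOneSpectrum.primesEquiv v : Nat.Primes) : ℕ) = p →
      ∀ 𝔓 ∈ v.primesAbove, resLe (tateRep W p).toTopRep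
        (inf_le_left : cycSubgroup p k r ⊓ MulAction.stabilizer (absoluteGaloisGroup ℚ) 𝔓 ≤
          cycSubgroup p k r) 1 y = 0) :
    Λ y = 0 :=
  eq_zero_of_forall_primesAbove_of_singleField W p k r Λ Ψ w₀ hU φ₀ S g
    (singleField_classDef_of_cocycleDef W p k r Λ Ψ w₀ hU φ₀ S g hdef) y hy

/-! ## (C3a) from the displayed (DEF₀) and LOCAL equivariance, every level -/

set_option backward.isDefEq.respectTransparency false in
/-- **`ZetaBody` (C3a) VERBATIM from the displayed (DEF₀) and the LOCAL equivariance (GAL_D)**, at every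
level `(k, r)`: with `φ₀` the defined `exp*_{w₀}` (additive, values in `L_{w₀}`), twist family `g` with
`g̃_w • w = w₀`, (DEF₀) on cocycles as displayed in `hKdef₀`/`hKatoV2₀`, and
(GAL_D) «`φ₀ (loc (H1toInt (res δ̂ · Y))) = (res δ̂)~_* (φ₀ (loc (H1toInt Y)))` for `δ̂ ∈ Γ_{ℚ_v}` whose image
fixes `w₀`»: **`Λ (σ · y) = (1 ⊗ σ̃) Λ(y)`** for all `σ ∈ Γ_ℚ`
(`conjMap_eq_map_sigma_of_singleField` ∘ `singleField_classDef_of_cocycleDef` ∘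
`singleField_gal_of_galDecomposition_all`). [cite: Kato2004Asterisque, §9.4 (p. 188)]
[cite: NeukirchANT1999, Ch. I §9 (9.1)–(9.3) and Ch. II §9 Prop. (9.6)] -/
theorem zetaBody_C3a_of_cocycleDef_of_galDecomposition
    (hΨ : ∀ (s : ℚ_[p]) (x : CyclotomicField (cycLevel p k r) ℚ)
      (w : ((Rat.HeightOneSpectrum.primesEquiv (R := 𝓞 ℚ)).symm ⟨p, Fact.out⟩).Extension
        (𝓞 (CyclotomicField (cycLevel p k r) ℚ))),
      Ψ (s ⊗ₜ[ℚ] x) w = algebraMap (CyclotomicField (cycLevel p k r) ℚ)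
          (w.1.adicCompletion (CyclotomicField (cycLevel p k r) ℚ)) x *
        algebraMap (((Rat.HeightOneSpectrum.primesEquiv (R := 𝓞 ℚ)).symm ⟨p, Fact.out⟩).adicCompletion ℚ)
          (w.1.adicCompletion (CyclotomicField (cycLevel p k r) ℚ)) (Padic.adicCompletionEquiv (𝓞 ℚ) ⟨p, Fact.out⟩ s))
    (φ₀' : ((tateLocalRep W p (Sum.inr ((Rat.HeightOneSpectrum.primesEquiv (R := 𝓞 ℚ)).symm ⟨p, Fact.out⟩))).restrict
      (absGaloisRestrict (Place.Completion (Sum.inr ((Rat.HeightOneSpectrum.primesEquiv (R := 𝓞 ℚ)).symm ⟨p, Fact.out⟩))) (w₀.1.adicCompletion (CyclotomicField (cycLevel p k r) ℚ)))).cohomology 1 →+ (w₀.1.adicCompletion (CyclotomicField (cycLevel p k r) ℚ)))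
    (hg : ∀ w : ((Rat.HeightOneSpectrum.primesEquiv (R := 𝓞 ℚ)).symm ⟨p, Fact.out⟩).Extension
        (𝓞 (CyclotomicField (cycLevel p k r) ℚ)),
      sigma (cycLevel p k r) (modNCyclotomicCharacter ℚ (cycLevel p k r) (g w)) • w.1 = w₀.1)
    (hdef : ∀ (w : ((Rat.HeightOneSpectrum.primesEquiv (R := 𝓞 ℚ)).symm ⟨p, Fact.out⟩).Extension
        (𝓞 (CyclotomicField (cycLevel p k r) ℚ)))
      (y : H1 (tateRep W p) (cycSubgroup p k r))
      (φ'' : contOneCocycles (subgroupRep (tateRep W p).toTopRep (cycSubgroup p k r)))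
      (ψT : contOneCocycles ((tateLocalRep W p (Sum.inr ((Rat.HeightOneSpectrum.primesEquiv (R := 𝓞 ℚ)).symm ⟨p, Fact.out⟩))).restrict
        (absGaloisRestrict (Place.Completion (Sum.inr ((Rat.HeightOneSpectrum.primesEquiv (R := 𝓞 ℚ)).symm ⟨p, Fact.out⟩))) (w₀.1.adicCompletion (CyclotomicField (cycLevel p k r) ℚ)))).toTopRep),
      oneCocycleClass _ φ'' = conjMap (tateRep W p).toTopRep (cycSubgroup p k r) (g w) 1 y →
      (∀ σ, ψT.1 σ = φ''.1 ⟨absGaloisRestrictTower ℚ (Place.Completion (Sum.inr ((Rat.HeightOneSpectrum.primesEquiv (R := 𝓞 ℚ)).symm ⟨p, Fact.out⟩))) (w₀.1.adicCompletion (CyclotomicField (cycLevel p k r) ℚ)) σ, hU σ⟩) →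
      Ψ (Λ y) w = galAdicCompletionMap
        (sigma (cycLevel p k r) (modNCyclotomicCharacter ℚ (cycLevel p k r) (g w)))⁻¹
        (inv_smul_eq_of_smul_eq (hg w)) (φ₀' (oneCocycleClass _ ψT)))
    (hgalD : ∀ (δ' : absoluteGaloisGroup (((Rat.HeightOneSpectrum.primesEquiv (R := 𝓞 ℚ)).symm ⟨p, Fact.out⟩).adicCompletion ℚ))
      (hδ : sigma (cycLevel p k r) (modNCyclotomicCharacter ℚ (cycLevel p k r)
        (absGaloisRestrict ℚ (((Rat.HeightOneSpectrum.primesEquiv (R := 𝓞 ℚ)).symm ⟨p, Fact.out⟩).adicCompletion ℚ) δ')) • w₀.1 = w₀.1)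
      (Y : H1 (tateRep W p) (cycSubgroup p k r)),
      φ₀' (locTower ℚ (Place.Completion (Sum.inr ((Rat.HeightOneSpectrum.primesEquiv (R := 𝓞 ℚ)).symm ⟨p, Fact.out⟩))) (w₀.1.adicCompletion (CyclotomicField (cycLevel p k r) ℚ)) (tateRep W p).toIntRep.toTopRep (cycSubgroup p k r) hU 1
        (((tateRep W p).level (cycSubgroup p k r)).H1toInt
          (conjMap (tateRep W p).toTopRep (cycSubgroup p k r) (absGaloisRestrict ℚ (((Rat.HeightOneSpectrum.primesEquiv (R := 𝓞 ℚ)).symm ⟨p, Fact.out⟩).adicCompletion ℚ) δ') 1 Y))) =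
        galAdicCompletionMap (sigma (cycLevel p k r) (modNCyclotomicCharacter ℚ (cycLevel p k r)
          (absGaloisRestrict ℚ (((Rat.HeightOneSpectrum.primesEquiv (R := 𝓞 ℚ)).symm ⟨p, Fact.out⟩).adicCompletion ℚ) δ'))) hδ
          (φ₀' (locTower ℚ (Place.Completion (Sum.inr ((Rat.HeightOneSpectrum.primesEquiv (R := 𝓞 ℚ)).symm ⟨p, Fact.out⟩))) (w₀.1.adicCompletion (CyclotomicField (cycLevel p k r) ℚ)) (tateRep W p).toIntRep.toTopRep (cycSubgroup p k r) hU 1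
            (((tateRep W p).level (cycSubgroup p k r)).H1toInt Y))))
    (σ : absoluteGaloisGroup ℚ) (y : H1 (tateRep W p) (cycSubgroup p k r)) :
    Λ (conjMap (tateRep W p).toTopRep (cycSubgroup p k r) σ 1 y) =
      Algebra.TensorProduct.map (AlgHom.id ℚ ℚ_[p])
        (sigma (cycLevel p k r) (modNCyclotomicCharacter ℚ (cycLevel p k r) σ) :
          CyclotomicField (cycLevel p k r) ℚ →ₐ[ℚ] CyclotomicField (cycLevel p k r) ℚ) (Λ y) := by
  -- `F := φ₀ ∘ loc^{tower}_{w₀} ∘ H1toInt`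
  let F : H1 (tateRep W p) (cycSubgroup p k r) →+ (w₀.1.adicCompletion (CyclotomicField (cycLevel p k r) ℚ)) :=
    φ₀'.comp (((locTower ℚ (Place.Completion (Sum.inr ((Rat.HeightOneSpectrum.primesEquiv (R := 𝓞 ℚ)).symm ⟨p, Fact.out⟩))) (w₀.1.adicCompletion (CyclotomicField (cycLevel p k r) ℚ)) (tateRep W p).toIntRep.toTopRep (cycSubgroup p k r) hU 1).hom.toLinearMap.toAddMonoidHom).comp
      ((tateRep W p).level (cycSubgroup p k r)).H1toInt)
  have hF : ∀ Y, F Y = φ₀' (locTower ℚ (Place.Completion (Sum.inr ((Rat.HeightOneSpectrum.primesEquiv (R := 𝓞 ℚ)).symm ⟨p, Fact.out⟩))) (w₀.1.adicCompletion (CyclotomicField (cycLevel p k r) ℚ)) (tateRep W p).toIntRep.toTopRep (cycSubgroup p k r) hU 1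
      (((tateRep W p).level (cycSubgroup p k r)).H1toInt Y)) := fun _ => rfl
  have hclass := singleField_classDef_of_cocycleDef W p k r Λ Ψ w₀ hU φ₀'
    (fun w => (galAdicCompletionMap (sigma (cycLevel p k r) (modNCyclotomicCharacter ℚ (cycLevel p k r) (g w)))⁻¹
      (inv_smul_eq_of_smul_eq (hg w))).toAddMonoidHom) g hdef
  refine conjMap_eq_map_sigma_of_singleField W p k r Λ Ψ hΨ w₀ F g hg
    (fun w Y => by rw [hF]; exact hclass w Y) ?_ σ y
  intro δ hδ Y
  rw [hF, hF]
  exact singleField_gal_of_galDecomposition_all p k r W w₀ F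
    (fun δ' hδ' Y' => by rw [hF, hF]; exact hgalD δ' hδ' Y') δ hδ Y

end Summit.BirchSwinnertonDyer.BirchSwinnertonDyer.Theorems.KimAtThreeFineKatoValueEquivarianceBridge

end
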